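import Literature.Computability.Cryptography.SchemesProofs
import Literature.Computability.Cryptography.CommitmentOneWay
import HarnessLib

/-!
# Bit commitment ⇒ one-way functions ⇒ signatures: the discharge of `OWFExist_of_bitCommitmentExist`
# and the reduction of `secureSignaturesExist_of_bitCommitmentExist` to Rompel's theorem

Sibling proof file of `Schemes.lean` (D-0014), joining two proved developments that must not import
each other's umbrella: `CommitmentOneWay.lean` (Impagliazzo–Luby 1989, Thm. 1 for bit commitment:
`CommitOWF.OWFExist_of_bitCommitmentExist_proved : BitCommitmentExist → OWFExist`, via a weakly
one-way function and Yao's amplification) and `SchemesProofs.lean` (the hypothesis-explicit assembly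
of crypto-foundations.S13/S23).

* `OWFExist_of_bitCommitmentExist_holds` — the closed discharge of the named fact
  `OWFExist_of_bitCommitmentExist` (`Schemes.lean`). It was first appended to `SchemesProofs.lean`
  (gate proposal p29757) and was lost there in a concurrent whole-file resubmission of that file; it
  is re-landed here, in a file of its own, with the same one-line proof.
* `secureSignaturesExist_of_bitCommitmentExist_of_OWF` — with Impagliazzo–Luby's half now a theorem,
  the corollary `secureSignaturesExist_of_bitCommitmentExist` (bit commitment ⇒ EUF-CMA-secure
  signatures) depends on exactly ONE remaining named fact, `secureSignaturesExist_of_OWFExist`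
  (Rompel 1990, Thm. 3 = Goldreich 2004, Thm. 6.4.1: one-way functions ⇒ secure signature schemes);
  `…_of_iff` and `…_of_oneTimeSecure` are the same reduction through the packaged equivalence
  `secureSignaturesExist_iff_OWFExist` and through Goldreich's printed assembly of Thm. 6.4.1 from its
  two one-time-signature halves (`secureSignaturesExist_of_OWFExist_of_oneTimeSecure`).
* `exists_isOneTimeSecure_of_bitCommitmentExist_of` — the intermediate station under Rompel's theorem
  (one-time signature schemes); the unconditional station "bit commitment ⇒ weak one-way functions"
  is `CommitOWF.weakOWFExist_of_bitCommitmentExist` (`CommitmentOneWay.lean`).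

No statement is changed and no named fact is introduced: every declaration below is a proved theorem.
The discharge `secureSignaturesExist_of_bitCommitmentExist_holds` itself is NOT here: in the tree's
uniform, stateless model it is `secureSignaturesExist_of_OWFExist_holds ∘ OWFExist_of_bitCommitmentExist_holds`,
and the first factor (OWF ⇒ UOWHF ⇒ one-time signatures ⇒ authentication trees made memoryless with
pseudorandom functions, Goldreich 2004, §6.4.1–6.4.3, consuming also `PRGExist_iff_OWFExist` and
`GGM1986_thm3`) is not yet proved in the tree.

## References

* R. Impagliazzo, M. Luby, *One-way functions are essential for complexity based cryptography*,
  FOCS 1989, Theorem 1.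
* J. Rompel, *One-way functions are necessary and sufficient for secure signatures*, STOC 1990,
  Theorem 3 (uniform model).
* O. Goldreich, *Foundations of Cryptography I: Basic Tools*, CUP 2001, Ch. 4, Exercise 13;
  Thm. 2.3.2.
* O. Goldreich, *Foundations of Cryptography II: Basic Applications*, CUP 2004, Thm. 6.4.1 and
  §6.4.3.4 ("combining Theorems 6.4.29, 6.4.32, and 6.4.9, we establish Theorem 6.4.1").
-/

namespace Literature.Computability.Cryptography

/-- **crypto-foundations.S13, bit-commitment half (discharge of `OWFExist_of_bitCommitmentExist`)**:
if there is an efficient, computationally hiding, statistically binding non-interactive bit-commitment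
scheme, then one-way functions exist. The proof is `CommitOWF.OWFExist_of_bitCommitmentExist_proved`
(`CommitmentOneWay.lean`): the map "guess the coin count, commit to `1` with the next input bits" is
weakly one-way by unambiguity-then-secrecy (Goldreich 2001, Ch. 4, Exercise 13, guideline), and Yao's
amplification (Goldreich 2001, Thm. 2.3.2, `weakOWFExist_iff_OWFExist_holds`) makes it strongly one-way.
[Impagliazzo–Luby 1989, Thm. 1; Goldreich 2001, Ch. 4, Exercise 13] [cite: ImpagliazzoLuby1989, Thm. 1] -/
theorem OWFExist_of_bitCommitmentExist_holds : OWFExist_of_bitCommitmentExist :=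
  fun h => CommitOWF.OWFExist_of_bitCommitmentExist_proved h

/-- **Reduction of the corollary to Rompel's theorem alone.** With Impagliazzo–Luby's half proved
(`OWFExist_of_bitCommitmentExist_holds`), bit commitment ⇒ EUF-CMA-secure signatures follows from the
single named fact `secureSignaturesExist_of_OWFExist` (one-way functions ⇒ secure signature schemes).
[Impagliazzo–Luby 1989, Thm. 1; Rompel 1990, Thm. 3; Goldreich 2004, Thm. 6.4.1]
[cite: ImpagliazzoLuby1989, Thm. 1] -/
theorem secureSignaturesExist_of_bitCommitmentExist_of_OWF (h : secureSignaturesExist_of_OWFExist) :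
    secureSignaturesExist_of_bitCommitmentExist :=
  secureSignaturesExist_of_bitCommitmentExist_of OWFExist_of_bitCommitmentExist_holds h

/-- The same reduction through the packaged equivalence **S23** (`secureSignaturesExist_iff_OWFExist`,
of which only the hard direction is used). [Rompel 1990 (title theorem); Goldreich 2004, Thm. 6.4.1]
[cite: Rompel1990, Thm. 3] -/
theorem secureSignaturesExist_of_bitCommitmentExist_of_iff (h : secureSignaturesExist_iff_OWFExist) :
    secureSignaturesExist_of_bitCommitmentExist :=
  secureSignaturesExist_of_bitCommitmentExist_of_OWF h.2

/-- The same reduction through **Goldreich's printed assembly of Thm. 6.4.1** from its two halves over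
one-time signature schemes (`SignatureScheme.IsOneTimeSecure`, Goldreich 2004, Def. 6.4.2):
`h₁` = Thm. 6.4.29 with Thm. 6.4.32 (one-way functions ⇒ UOWHFs ⇒ secure one-time signature schemes),
`h₂` = Thm. 6.4.9 (secure one-time signature schemes ⇒ secure memoryless signature schemes, by
authentication trees and pseudorandom functions). [Goldreich 2004, Thm. 6.4.1 and §6.4.3.4]
[cite: Goldreich2004, Thm. 6.4.1 and §6.4.3.4] -/
theorem secureSignaturesExist_of_bitCommitmentExist_of_oneTimeSecure
    (h₁ : OWFExist → ∃ S : SignatureScheme, S.IsOneTimeSecure)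
    (h₂ : (∃ S : SignatureScheme, S.IsOneTimeSecure) → SecureSignaturesExist) :
    secureSignaturesExist_of_bitCommitmentExist :=
  secureSignaturesExist_of_bitCommitmentExist_of_OWF (secureSignaturesExist_of_OWFExist_of_oneTimeSecure h₁ h₂)

/-- Under Rompel's theorem, bit commitment already yields a secure *one-time* signature scheme
(through one-way functions and `SignatureScheme.IsEUFCMA.isOneTimeSecure`).
[Goldreich 2004, Thm. 6.4.1 with §6.4.1 (remark after Def. 6.4.1)] [cite: Goldreich2004, Thm. 6.4.1] -/
theorem exists_isOneTimeSecure_of_bitCommitmentExist_of (h : secureSignaturesExist_of_OWFExist)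
    (hc : BitCommitmentExist) : ∃ S : SignatureScheme, S.IsOneTimeSecure :=
  exists_isOneTimeSecure_of_OWFExist_of h (OWFExist_of_bitCommitmentExist_holds hc)

end Literature.Computability.Cryptography
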